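import Literature.NumberTheory.DiophantineGeometry.GenEllRootHeights
import Mathlib.NumberTheory.NumberField.InfinitePlace.Embeddings
import HarnessLib

/-!
# [GenEll] Thm. 2.1, mechanism bookkeeping: the fibre `B = roots of p·q·(p−q)` read in a number field —
# its cardinality and the heights of its elements are field-independent

S. Mochizuki, *Arithmetic elliptic curves in general position*, Math. J. Okayama Univ. **52** (2010), proof
of Thm. 2.1 pp. 12–13 [cite: MochizukiGenEll2010, Thm 2.1 proof p.12]. Junction file (proof-only) for the
abc-iut cell's route item `GenEllTwo` (stmt-ABC-19679), NFPoint layer of «GenEllMechanismKappa»: the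
conductor slope is applied in a number field `L` in which the mechanism's cusp polynomial `M ∈ ℤ[X]`
SPLITS, with `B :=` the set of its roots in `L`; the slope's constants involve `|B|` and the heights of the
`b ∈ B`. Both are independent of `L`:

* `card_rootFinset_map_eq_of_splits` — if `M` splits in `L`, the number of distinct roots of `M` in `L`
  equals the number of distinct roots in `ℂ` (embed `L ↪ ℂ`; roots of a split polynomial map bijectively);
* `exists_logHeight₁_root_le` — for `M ≠ 0` there is `C₆` with `h_L(b) ≤ [L:ℚ]·C₆` for every root `b` of `M`
  in every number field `L` (abc-iut-w4-d032's root-height bound `exists_ht_le_of_aeval_eq_zero`, rescaled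
  from the normalised height `ht`).

Classical; nothing here bears on [IUTchIII] Cor. 3.12.
-/

noncomputable section

open Polynomial NumberField Height
open scoped Classical

namespace Literature.NumberTheory.DiophantineGeometry.GenEll

/-- **Distinct roots of a split integer polynomial are counted field-independently.** For a number field
`L` in which `M ∈ ℤ[X]` splits, `|{roots of M in L}| = |{roots of M in ℂ}|`.
[cite: MochizukiGenEll2010, Thm 2.1 proof p.12] -/
theorem card_rootFinset_map_eq_of_splits (M : ℤ[X]) (L : Type*) [Field L] [NumberField L]
    (hsplit : (M.map (Int.castRingHom L)).Splits) :
    ((M.map (Int.castRingHom L)).roots.toFinset).card =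
      ((M.map (Int.castRingHom ℂ)).roots.toFinset).card := by
  obtain ⟨σ⟩ : Nonempty (L →+* ℂ) := inferInstance
  have hmap : M.map (Int.castRingHom ℂ) = (M.map (Int.castRingHom L)).map σ := by
    rw [Polynomial.map_map]
    congr 1
    exact RingHom.ext_int _ _
  rw [hmap, hsplit.roots_map_of_injective σ.injective, Multiset.toFinset_map,
    Finset.card_image_of_injective _ σ.injective]

/-- **Uniform height bound for the roots of a fixed integer polynomial.** For `M ≠ 0` there is `C₆` with
`h_L(b) ≤ [L:ℚ]·C₆` for every root `b ∈ L` of `M`, every number field `L`.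
[cite: MochizukiGenEll2010, Prop 1.4 p.6] -/
theorem exists_logHeight₁_root_le (M : ℤ[X]) (hM : M ≠ 0) :
    ∃ C₆ : ℝ, ∀ (L : Type) [Field L] [NumberField L] (b : L), aeval b M = 0 →
      logHeight₁ b ≤ Module.finrank ℚ L * C₆ := by
  obtain ⟨H, hH⟩ := NFPoint.exists_ht_le_of_aeval_eq_zero M hM
  refine ⟨H, fun L _ _ b hb => ?_⟩
  have h := hH ⟨L, b⟩ hb
  have hdeg : (0 : ℝ) < Module.finrank ℚ L := by exact_mod_cast Module.finrank_pos
  change ((Module.finrank ℚ L : ℕ) : ℝ)⁻¹ * logHeight₁ b ≤ H at h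
  rwa [inv_mul_le_iff₀ hdeg] at h

/-- The same for the elements of the root finset of `M` in `L`. [cite: MochizukiGenEll2010, Prop 1.4 p.6] -/
theorem exists_logHeight₁_rootFinset_le (M : ℤ[X]) (hM : M ≠ 0) :
    ∃ C₆ : ℝ, ∀ (L : Type) [Field L] [NumberField L],
      ∀ b ∈ (M.map (Int.castRingHom L)).roots.toFinset, logHeight₁ b ≤ Module.finrank ℚ L * C₆ := by
  obtain ⟨C₆, hC₆⟩ := exists_logHeight₁_root_le M hM
  refine ⟨C₆, fun L _ _ b hb => hC₆ L b ?_⟩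
  have hM' : M.map (Int.castRingHom L) ≠ 0 :=
    (Polynomial.map_ne_zero_iff (Int.castRingHom L).injective_int).mpr hM
  have hroot := (Multiset.mem_toFinset.mp hb)
  rw [mem_roots hM', IsRoot, eval_map] at hroot
  -- `aeval b M` is `eval₂ (algebraMap ℤ L) b M`, and `Int.castRingHom L = algebraMap ℤ L`
  rwa [aeval_def, show algebraMap ℤ L = Int.castRingHom L from RingHom.ext_int _ _]

end Literature.NumberTheory.DiophantineGeometry.GenEll

end
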